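import Literature.NumberTheory.EllipticCurves.IwasawaSelmerDualUniquenessProofs
import Mathlib.Algebra.Module.Injective
import Mathlib.Algebra.Module.CharacterModule
import HarnessLib

/-!
# Functoriality of the Pontryagin dual `X(E/K_∞)`: the `Λ`-linear dual of a `Γ`-equivariant map of
# Selmer groups, and the transfer of kernel/cokernel bounds (THEOREMS + two auxiliary definitions)

Greenberg, *Iwasawa theory for elliptic curves*, LNM 1716 (1999), §1 (p. 60): the `Λ`-module structure
of `H¹(F_∞, E[p^∞])` (hence of every Selmer group inside it and of its Pontryagin dual) is determined by
the action of `γ` («every element of which is killed by `Tⁿ` for some `n`. Thus, `H¹(F_∞, E[p^∞])` is a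
`Λ`-module»). In the tree this is `WeierstrassCurve.SelmerDualData.toDual_smul`
(`IwasawaSelmerDualUniquenessProofs`): `toDual (f • x) = f ⋆ toDual x` with `⋆` the canonical action
`IwasawaDual.IsLocNil.smulFun` attached to `ψ = conj_γ − 1`. This file draws the functorial consequence,
needed whenever two Selmer groups over `ℤ_p`-towers — possibly of DIFFERENT curves over DIFFERENT base
fields — are compared by an additive map commuting with the chosen generators (restriction along a
quadratic extension of the tower, twisting isomorphisms `E^{(d)}[p^∞] ≅ E[p^∞]`, isogenies):

* §1 `IwasawaDual.IsLocNil.smulFun_comp`: NATURALITY of the canonical action — for `Φ : S₁ →+ S₂` with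
  `Φ ∘ ψ₁ = ψ₂ ∘ Φ`, `(f ⋆₂ y) ∘ Φ = f ⋆₁ (y ∘ Φ)`.
* §2 (generic, «dual data» unbundled: `X` a `Λ`-module, `toDual : X →+ Hom(S, ℚ/ℤ)` bijective with
  `toDual (f • x) = f ⋆ toDual x`) `IwasawaDual.dualHom`: the transpose `X₂ → X₁` of `Φ`, characterised by
  `toDual₁ (dualHom x) = toDual₂ x ∘ Φ`; it is `Λ`-LINEAR (`dualHom_smul`); kernel/cokernel transfer:
  if `n • S₂ ⊆ Φ(S₁)` then `n` kills `ker dualHom` (`smul_eq_zero_of_dualHom_eq_zero`); if `n` kills `ker Φ`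
  then `n • X₁ ⊆ im dualHom` (`exists_dualHom_eq_smul`, by the injectivity of `ℚ/ℤ`); and the two-map
  version for a comparison `S₁ × S₁' → S₂`, `(s, s') ↦ Φ s + Φ' s'` (`smul_eq_zero_of_dualHom_eq_zero₂`,
  `exists_dualHom_pair_eq_smul`).
* §3 the `SelmerDualData` instances: `WeierstrassCurve.SelmerDualData.dualMap D₁ D₂ Φ hΦ :
  D₂.X →ₗ[Λ] D₁.X` for `Dᵢ : Wᵢ.SelmerDualData κᵢ γᵢ` (`Wᵢ` over number fields `Kᵢ`, `κᵢ` `ℤ_p`-extensions,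
  the SAME `p`) and `Φ : Sel_{p^∞}(W₁/K_{1,∞}) →+ Sel_{p^∞}(W₂/K_{2,∞})` with `Φ ∘ conj_{γ₁} = conj_{γ₂} ∘ Φ`,
  with `toDual_dualMap`, `smul_eq_zero_of_dualMap_eq_zero`, `exists_dualMap_eq_smul` and the two-map
  versions.

Everything is proved; no named fact, no instance, no `sorry`. Motivation (cell `bsd-2adic`, seat `t42` GEN 23,
crux stmt-BirchSwinnertonDyer-22618, repair item T20 (a) «twist decomposition»): the dual of the comparison
`Sel(E′/ℚ_∞) × Sel(E/ℚ_∞) → Sel(E′/F_∞)` along the quadratic layer `F_∞ = ℚ_∞(i)` (Dokchitser–Dokchitser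
2010 Lemma 4.14 mechanism, tree file `H1CorestrictionIndexTwo`) is a `Λ`-quasi-isomorphism
`X(E′/F_∞) → X(E′/ℚ_∞) × X(E/ℚ_∞)` with `2`-power-torsion kernel and cokernel; that application is NOT
made here.

## References

* [GreenbergLNM1716] R. Greenberg, LNM 1716 (1999), §1 (p. 60).
* [Washington1997] L. Washington, *Introduction to Cyclotomic Fields*, 2nd ed., §13.2.
* [DokchitserDokchitserAnnals2010] T. Dokchitser, V. Dokchitser, Ann. of Math. 172 (2010), Lemma 4.14.
* [Rubin2000] K. Rubin, *Euler Systems*, Ch. VI §1–§2 (twisting by characters of `Γ`).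
-/

noncomputable section

open scoped Classical

universe u v

namespace Literature.NumberTheory.EllipticCurves

namespace IwasawaDual

/-! ## §1 Naturality of the canonical action `IsLocNil.smulFun` -/

section Naturality

variable {S₁ S₂ : Type*} [AddCommGroup S₁] [AddCommGroup S₂] {A : Type*} [AddCommGroup A]
  {p : ℕ} [Fact p.Prime] {ψ₁ : AddMonoid.End S₁} {ψ₂ : AddMonoid.End S₂}
  (h₁ : IsLocNil p ψ₁) (h₂ : IsLocNil p ψ₂) (Φ : S₁ →+ S₂) (hΦ : ∀ s, Φ (ψ₁ s) = ψ₂ (Φ s))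

include hΦ in
/-- `Φ ∘ ψ₁^i = ψ₂^i ∘ Φ`. [folklore] -/
private theorem map_pow_apply (i : ℕ) (s : S₁) : Φ ((ψ₁ ^ i) s) = (ψ₂ ^ i) (Φ s) := by
  induction i generalizing s with
  | zero => simp
  | succ i ih =>
    rw [pow_succ, pow_succ, AddMonoid.End.coe_mul, AddMonoid.End.coe_mul, Function.comp_apply,
      Function.comp_apply, ih, hΦ]

include hΦ in
/-- Truncated evaluations are natural: `evalT ψ₂ N k f y (Φ s) = evalT ψ₁ N k f (y ∘ Φ) s`. [folklore] -/
private theorem evalT_comp_apply (N k : ℕ) (f : PowerSeries ℤ_[p]) (y : S₂ →+ A) (s : S₁) :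
    evalT p ψ₂ N k f y (Φ s) = evalT p ψ₁ N k f (y.comp Φ) s := by
  simp only [evalT_def, AddMonoidHom.coe_comp, Function.comp_apply, map_pow_apply Φ hΦ]

include hΦ in
/-- **Naturality of the canonical `ℤ_p⟦T⟧`-action on `Hom(S, A)`**: for `Φ : S₁ →+ S₂` intertwining the
locally nilpotent operators (`Φ ∘ ψ₁ = ψ₂ ∘ Φ`), `(f ⋆₂ y) (Φ s) = (f ⋆₁ (y ∘ Φ)) s` — both sides are the
same finite sum `∑ coeffᵢ(f) · y(Φ(ψ₁ⁱ s))`, computed with truncation parameters admissible for `s`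
(which are admissible for `Φ s`). Greenberg (1999), §1 (p. 60); Washington §13.2.
[cite: GreenbergLNM1716, §1 (p. 60)] -/
theorem IsLocNil.smulFun_comp_apply (f : PowerSeries ℤ_[p]) (y : S₂ →+ A) (s : S₁) :
    h₂.smulFun f y (Φ s) = h₁.smulFun f (y.comp Φ) s := by
  obtain ⟨N, hN⟩ := h₁.nil s
  obtain ⟨k, hk⟩ := h₁.torsion s
  have hN₂ : (ψ₂ ^ N) (Φ s) = 0 := by rw [← map_pow_apply Φ hΦ, hN, map_zero]
  have hk₂ : p ^ k • Φ s = 0 := by rw [← map_nsmul, hk, map_zero]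
  rw [h₂.smulFun_apply f y hN₂ hk₂, h₁.smulFun_apply f _ hN hk, evalT_comp_apply Φ hΦ]

include hΦ in
/-- Naturality, as an identity of homomorphisms: `(f ⋆₂ y) ∘ Φ = f ⋆₁ (y ∘ Φ)`.
[cite: GreenbergLNM1716, §1 (p. 60)] -/
theorem IsLocNil.smulFun_comp (f : PowerSeries ℤ_[p]) (y : S₂ →+ A) :
    (h₂.smulFun f y).comp Φ = h₁.smulFun f (y.comp Φ) := by
  ext s
  exact IsLocNil.smulFun_comp_apply h₁ h₂ Φ hΦ f y s

end Naturality

/-! ## §2 The transpose of `Φ` on Pontryagin duals (unbundled dual data) -/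

section DualHom

variable {S₁ S₂ : Type*} [AddCommGroup S₁] [AddCommGroup S₂]
  {X₁ : Type*} [AddCommGroup X₁] {X₂ : Type*} [AddCommGroup X₂]
  (toDual₁ : X₁ →+ (S₁ →+ AddCircle (1 : ℚ))) (hbij₁ : Function.Bijective toDual₁)
  (toDual₂ : X₂ →+ (S₂ →+ AddCircle (1 : ℚ))) (Φ : S₁ →+ S₂)

/-- Precomposition with `Φ` on `ℚ/ℤ`-valued characters, as an additive map. [folklore] -/
def precomp (Φ : S₁ →+ S₂) : (S₂ →+ AddCircle (1 : ℚ)) →+ (S₁ →+ AddCircle (1 : ℚ)) where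
  toFun y := y.comp Φ
  map_zero' := by ext; simp
  map_add' y y' := by ext; simp

/-- Values of `precomp`. [cite: Washington1997, §13.2] -/
@[simp]
theorem precomp_apply (Φ : S₁ →+ S₂) (y : S₂ →+ AddCircle (1 : ℚ)) (s : S₁) : precomp Φ y s = y (Φ s) :=
  rfl

/-- **The transpose `Φ^∨ : X₂ → X₁`** of `Φ : S₁ → S₂` through the identifications `toDualᵢ : Xᵢ ≅ Hom(Sᵢ, ℚ/ℤ)`
(`toDual₁` bijective): `x ↦ toDual₁⁻¹ (toDual₂ x ∘ Φ)`. Washington §13.2 (Pontryagin duality).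
[cite: Washington1997, §13.2] -/
def dualHom : X₂ →+ X₁ :=
  ((AddEquiv.ofBijective toDual₁ hbij₁).symm : (S₁ →+ AddCircle (1 : ℚ)) →+ X₁).comp
    ((precomp Φ).comp toDual₂)

/-- The defining identity `toDual₁ (Φ^∨ x) = toDual₂ x ∘ Φ`. [cite: Washington1997, §13.2] -/
@[simp]
theorem toDual_dualHom (x : X₂) : toDual₁ (dualHom toDual₁ hbij₁ toDual₂ Φ x) = (toDual₂ x).comp Φ := by
  unfold dualHom
  rw [AddMonoidHom.comp_apply, AddMonoidHom.comp_apply]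
  exact (AddEquiv.ofBijective toDual₁ hbij₁).apply_symm_apply _

/-- The defining identity, evaluated: `toDual₁ (Φ^∨ x) s = toDual₂ x (Φ s)`. [cite: Washington1997, §13.2] -/
theorem toDual_dualHom_apply (x : X₂) (s : S₁) :
    toDual₁ (dualHom toDual₁ hbij₁ toDual₂ Φ x) s = toDual₂ x (Φ s) := by
  rw [toDual_dualHom]; rfl

variable {p : ℕ} [Fact p.Prime] {ψ₁ : AddMonoid.End S₁} {ψ₂ : AddMonoid.End S₂}
  (h₁ : IsLocNil p ψ₁) (h₂ : IsLocNil p ψ₂)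
  [Module (PowerSeries ℤ_[p]) X₁] [Module (PowerSeries ℤ_[p]) X₂]
  (hsmul₁ : ∀ (f : PowerSeries ℤ_[p]) (x : X₁), toDual₁ (f • x) = h₁.smulFun f (toDual₁ x))
  (hsmul₂ : ∀ (f : PowerSeries ℤ_[p]) (x : X₂), toDual₂ (f • x) = h₂.smulFun f (toDual₂ x))
  (hΦ : ∀ s, Φ (ψ₁ s) = ψ₂ (Φ s))

include hsmul₁ hsmul₂ hΦ in
/-- **`Φ^∨` is `ℤ_p⟦T⟧`-linear** when both `Λ`-structures are the canonical ones read through `toDualᵢ`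
(`toDualᵢ (f • x) = f ⋆ᵢ toDualᵢ x`) and `Φ` intertwines `ψ₁`, `ψ₂`: by the naturality of `⋆`
(`IsLocNil.smulFun_comp`). Greenberg (1999), §1 (p. 60). [cite: GreenbergLNM1716, §1 (p. 60)] -/
theorem dualHom_smul (f : PowerSeries ℤ_[p]) (x : X₂) :
    dualHom toDual₁ hbij₁ toDual₂ Φ (f • x) = f • dualHom toDual₁ hbij₁ toDual₂ Φ x := by
  apply hbij₁.1
  rw [toDual_dualHom, hsmul₁, toDual_dualHom, hsmul₂, IsLocNil.smulFun_comp h₁ h₂ Φ hΦ]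

/-- **`Φ^∨` as a `Λ`-linear map** (`dualHom` with `dualHom_smul`). [cite: GreenbergLNM1716, §1 (p. 60)] -/
def dualLinearMap : X₂ →ₗ[PowerSeries ℤ_[p]] X₁ where
  toFun := dualHom toDual₁ hbij₁ toDual₂ Φ
  map_add' := map_add _
  map_smul' f x := dualHom_smul toDual₁ hbij₁ toDual₂ Φ h₁ h₂ hsmul₁ hsmul₂ hΦ f x

/-- `dualLinearMap` is `dualHom` on elements. [cite: GreenbergLNM1716, §1 (p. 60)] -/
@[simp]
theorem dualLinearMap_apply (x : X₂) :
    dualLinearMap toDual₁ hbij₁ toDual₂ Φ h₁ h₂ hsmul₁ hsmul₂ hΦ x = dualHom toDual₁ hbij₁ toDual₂ Φ x :=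
  rfl

end DualHom

/-! ### Kernel and cokernel transfer -/

section Bounds

variable {S₁ S₂ : Type*} [AddCommGroup S₁] [AddCommGroup S₂]
  {X₁ : Type*} [AddCommGroup X₁] {X₂ : Type*} [AddCommGroup X₂]
  (toDual₁ : X₁ →+ (S₁ →+ AddCircle (1 : ℚ))) (hbij₁ : Function.Bijective toDual₁)
  (toDual₂ : X₂ →+ (S₂ →+ AddCircle (1 : ℚ))) (hbij₂ : Function.Bijective toDual₂) (Φ : S₁ →+ S₂)

/-- **Extension of a `ℚ/ℤ`-valued character from a subgroup** (`ℚ/ℤ` is divisible, hence an injective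
abelian group — Mathlib's `Module.Baer.of_divisible`). Washington §13.2. [folklore] -/
private theorem exists_character_extend {B : Type*} [AddCommGroup B] (C : AddSubgroup B)
    (χ : C →+ AddCircle (1 : ℚ)) : ∃ χ' : B →+ AddCircle (1 : ℚ), ∀ b : C, χ' b = χ b := by
  obtain ⟨χ', h⟩ := (Module.Baer.of_divisible (AddCircle (1 : ℚ))).extension_property_addMonoidHom
    C.subtype C.subtype_injective χ
  exact ⟨χ', fun b ↦ by rw [← h]; rfl⟩

/-- **Factorisation of a character through a homomorphism**: a character of `S₁` killing `ker Φ` is of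
the form `χ' ∘ Φ` (descend to `S₁ ⧸ ker Φ ≅ Φ(S₁)`, then extend from `Φ(S₁) ≤ S₂`). [folklore] -/
private theorem exists_character_comp_eq (χ : S₁ →+ AddCircle (1 : ℚ)) (hχ : ∀ s, Φ s = 0 → χ s = 0) :
    ∃ χ' : S₂ →+ AddCircle (1 : ℚ), χ'.comp Φ = χ := by
  let χq : S₁ ⧸ Φ.ker →+ AddCircle (1 : ℚ) := QuotientAddGroup.lift Φ.ker χ fun s hs ↦ hχ s hs
  let e : S₁ ⧸ Φ.ker ≃+ Φ.range := QuotientAddGroup.quotientKerEquivRange Φ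
  obtain ⟨χ', hχ'⟩ := exists_character_extend Φ.range (χq.comp (e.symm : Φ.range →+ S₁ ⧸ Φ.ker))
  refine ⟨χ', ?_⟩
  ext s
  have he : e (QuotientAddGroup.mk s) = ⟨Φ s, s, rfl⟩ := rfl
  rw [AddMonoidHom.comp_apply, show Φ s = ((⟨Φ s, s, rfl⟩ : Φ.range) : S₂) from rfl, hχ' ⟨Φ s, s, rfl⟩,
    AddMonoidHom.comp_apply, ← he]
  change χq (e.symm (e (QuotientAddGroup.mk s))) = χ s
  rw [AddEquiv.symm_apply_apply]
  rfl

include hbij₂ in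
/-- **Kernel transfer**: if `n • S₂ ⊆ Φ(S₁)` then `n` kills `ker Φ^∨` — a character of `S₂` vanishing on
`Φ(S₁)` vanishes on `n • S₂`, i.e. its `n`-th multiple is zero. Dokchitser–Dokchitser 2010, Lemma 4.14
(proof: «cokernel killed by `|G|²`», dualised). [cite: DokchitserDokchitserAnnals2010, Lemma 4.14 (proof)] -/
theorem smul_eq_zero_of_dualHom_eq_zero {n : ℕ} (hn : ∀ t : S₂, ∃ s : S₁, Φ s = n • t) {x : X₂}
    (hx : dualHom toDual₁ hbij₁ toDual₂ Φ x = 0) : n • x = 0 := by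
  apply hbij₂.1
  rw [map_nsmul, map_zero]
  ext t
  obtain ⟨s, hs⟩ := hn t
  have h := congrArg (fun y : S₁ →+ AddCircle (1 : ℚ) ↦ y s)
    ((toDual_dualHom toDual₁ hbij₁ toDual₂ Φ x).symm.trans (by rw [hx, map_zero]))
  simp only [AddMonoidHom.coe_comp, Function.comp_apply, hs, map_nsmul, AddMonoidHom.zero_apply] at h
  rw [AddMonoidHom.nsmul_apply, AddMonoidHom.zero_apply, h]

include hbij₂ in
/-- **Cokernel transfer**: if `n` kills `ker Φ` then `n • X₁ ⊆ Φ^∨(X₂)` — the character `n · toDual₁ y`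
kills `ker Φ`, so it factors through `Φ` (`exists_character_comp_eq`). Dokchitser–Dokchitser 2010,
Lemma 4.14 (proof: «kernel killed by `|G|²`», dualised). [cite: DokchitserDokchitserAnnals2010, Lemma 4.14 (proof)] -/
theorem exists_dualHom_eq_smul {n : ℕ} (hn : ∀ s : S₁, Φ s = 0 → n • s = 0) (y : X₁) :
    ∃ x : X₂, dualHom toDual₁ hbij₁ toDual₂ Φ x = n • y := by
  obtain ⟨χ', hχ'⟩ := exists_character_comp_eq Φ (n • toDual₁ y) fun s hs ↦ by
    rw [AddMonoidHom.nsmul_apply, ← map_nsmul, hn s hs, map_zero]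
  obtain ⟨x, hx⟩ := hbij₂.2 χ'
  refine ⟨x, hbij₁.1 ?_⟩
  rw [toDual_dualHom, hx, hχ', map_nsmul]

variable {S₁' : Type*} [AddCommGroup S₁'] {X₁' : Type*} [AddCommGroup X₁']
  (toDual₁' : X₁' →+ (S₁' →+ AddCircle (1 : ℚ))) (hbij₁' : Function.Bijective toDual₁') (Φ' : S₁' →+ S₂)

include hbij₂ in
/-- **Kernel transfer, two-map version**: for a comparison `(s, s') ↦ Φ s + Φ' s'` of `S₁ × S₁'` with
`S₂` whose image contains `n • S₂`, a common zero `x` of `Φ^∨` and `Φ'^∨` has `n • x = 0`.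
Dokchitser–Dokchitser 2010, Lemma 4.14 (the `±`-decomposition `X_p(E/F) = X⁺ ⊕ X⁻` up to `|G|`-power
torsion, dual form). [cite: DokchitserDokchitserAnnals2010, Lemma 4.14 (proof)] -/
theorem smul_eq_zero_of_dualHom_eq_zero₂ {n : ℕ} (hn : ∀ t : S₂, ∃ (s : S₁) (s' : S₁'), Φ s + Φ' s' = n • t)
    {x : X₂} (hx : dualHom toDual₁ hbij₁ toDual₂ Φ x = 0) (hx' : dualHom toDual₁' hbij₁' toDual₂ Φ' x = 0) :
    n • x = 0 := by
  apply hbij₂.1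
  rw [map_nsmul, map_zero]
  ext t
  obtain ⟨s, s', hs⟩ := hn t
  have h := congrArg (fun y : S₁ →+ AddCircle (1 : ℚ) ↦ y s)
    ((toDual_dualHom toDual₁ hbij₁ toDual₂ Φ x).symm.trans (by rw [hx, map_zero]))
  have h' := congrArg (fun y : S₁' →+ AddCircle (1 : ℚ) ↦ y s')
    ((toDual_dualHom toDual₁' hbij₁' toDual₂ Φ' x).symm.trans (by rw [hx', map_zero]))
  simp only [AddMonoidHom.coe_comp, Function.comp_apply, AddMonoidHom.zero_apply] at h h'
  rw [AddMonoidHom.nsmul_apply, AddMonoidHom.zero_apply, ← map_nsmul, ← hs, map_add, h, h', add_zero]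

include hbij₂ in
/-- **Cokernel transfer, two-map version**: if `Φ s + Φ' s' = 0` forces `n • s = 0` and `n • s' = 0`, then
every pair `(n • y, n • y')` is `(Φ^∨ x, Φ'^∨ x)` for one `x ∈ X₂` — the character
`n · (toDual₁ y ∘ pr₁ + toDual₁' y' ∘ pr₂)` of `S₁ × S₁'` kills the kernel of the comparison map, so it
factors through it. Dokchitser–Dokchitser 2010, Lemma 4.14 (dual form).
[cite: DokchitserDokchitserAnnals2010, Lemma 4.14 (proof)] -/
theorem exists_dualHom_pair_eq_smul {n : ℕ}
    (hn : ∀ (s : S₁) (s' : S₁'), Φ s + Φ' s' = 0 → n • s = 0 ∧ n • s' = 0) (y : X₁) (y' : X₁') :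
    ∃ x : X₂, dualHom toDual₁ hbij₁ toDual₂ Φ x = n • y ∧ dualHom toDual₁' hbij₁' toDual₂ Φ' x = n • y' := by
  -- the comparison map and the character of the product
  let Ψ : S₁ × S₁' →+ S₂ := Φ.coprod Φ'
  let χ : S₁ × S₁' →+ AddCircle (1 : ℚ) :=
    n • ((toDual₁ y).comp (AddMonoidHom.fst S₁ S₁') + (toDual₁' y').comp (AddMonoidHom.snd S₁ S₁'))
  obtain ⟨χ', hχ'⟩ := exists_character_comp_eq Ψ χ fun ss' hss' ↦ by
    obtain ⟨hs, hs'⟩ := hn ss'.1 ss'.2 (by simpa [Ψ, AddMonoidHom.coprod_apply] using hss')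
    simp only [χ, AddMonoidHom.nsmul_apply, AddMonoidHom.add_apply, AddMonoidHom.coe_comp,
      Function.comp_apply, AddMonoidHom.coe_fst, AddMonoidHom.coe_snd, smul_add, ← map_nsmul, hs, hs',
      map_zero, add_zero]
  obtain ⟨x, hx⟩ := hbij₂.2 χ'
  refine ⟨x, hbij₁.1 ?_, hbij₁'.1 ?_⟩
  · rw [toDual_dualHom, hx, map_nsmul]
    ext s
    have h := congrArg (fun g : S₁ × S₁' →+ AddCircle (1 : ℚ) ↦ g (s, 0)) hχ'
    simpa [Ψ, χ, AddMonoidHom.coprod_apply] using h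
  · rw [toDual_dualHom, hx, map_nsmul]
    ext s'
    have h := congrArg (fun g : S₁ × S₁' →+ AddCircle (1 : ℚ) ↦ g (0, s')) hχ'
    simpa [Ψ, χ, AddMonoidHom.coprod_apply] using h

end Bounds

end IwasawaDual

end Literature.NumberTheory.EllipticCurves

/-! ## §3 The `SelmerDualData` instances -/

namespace WeierstrassCurve

namespace SelmerDualData

open Literature.NumberTheory.EllipticCurves Literature.NumberTheory.EllipticCurves.IwasawaDual

variable {K₁ : Type u} [Field K₁] [NumberField K₁] {K₂ : Type v} [Field K₂] [NumberField K₂]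
  {p : ℕ} [Fact p.Prime] {W₁ : WeierstrassCurve K₁} {W₂ : WeierstrassCurve K₂}
  {κ₁ : ZpExtension K₁ p} {κ₂ : ZpExtension K₂ p}
  {γ₁ : Field.absoluteGaloisGroup K₁} {γ₂ : Field.absoluteGaloisGroup K₂}
  (D₁ : W₁.SelmerDualData κ₁ γ₁) (D₂ : W₂.SelmerDualData κ₂ γ₂)
  (Φ : W₁.selmerInfty κ₁ →+ W₂.selmerInfty κ₂)
  (hΦ : ∀ s, Φ (W₁.conjSelmerInfty κ₁ γ₁ s) = W₂.conjSelmerInfty κ₂ γ₂ (Φ s))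

include hΦ in
/-- `Φ` intertwines `ψᵢ = conj_{γᵢ} − 1`. [folklore] -/
private theorem map_conjSelmerInfty_sub_one (s : W₁.selmerInfty κ₁) :
    Φ ((W₁.conjSelmerInfty κ₁ γ₁ - 1) s) = (W₂.conjSelmerInfty κ₂ γ₂ - 1) (Φ s) := by
  rw [IwasawaDual.End_sub_apply, IwasawaDual.End_sub_apply, AddMonoid.End.one_apply,
    AddMonoid.End.one_apply, map_sub, hΦ]

/-- **The dual `Φ^∨ : X(W₂/K_{2,∞}) → X(W₁/K_{1,∞})` of a `Γ`-equivariant map of Selmer groups**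
`Φ : Sel_{p^∞}(W₁/K_{1,∞}) → Sel_{p^∞}(W₂/K_{2,∞})` (two curves over two number fields, two `ℤ_p`-towers
with chosen generators, `Φ ∘ conj_{γ₁} = conj_{γ₂} ∘ Φ`), for any Pontryagin-dual data `D₁`, `D₂`: the
`Λ`-LINEAR map with `D₁.toDual (Φ^∨ x) = D₂.toDual x ∘ Φ` (`Λ`-linearity: both structures are the
canonical ones, `SelmerDualData.toDual_smul`, and the canonical action is natural). Greenberg (1999), §1
(p. 60); Rubin VI §1–§2. [cite: GreenbergLNM1716, §1 (p. 60)] [cite: Rubin2000, Ch. VI §1–§2] -/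
def dualMap : D₂.X →ₗ[IwasawaAlgebra p] D₁.X :=
  dualLinearMap D₁.toDual D₁.bijective D₂.toDual Φ
    (W₁.isLocNil_conjSelmerInfty_sub_one' κ₁ γ₁) (W₂.isLocNil_conjSelmerInfty_sub_one' κ₂ γ₂)
    D₁.toDual_smul D₂.toDual_smul (map_conjSelmerInfty_sub_one Φ hΦ)

/-- The defining identity `D₁.toDual (Φ^∨ x) s = D₂.toDual x (Φ s)`. [cite: GreenbergLNM1716, §1 (p. 60)] -/
@[simp]
theorem toDual_dualMap (x : D₂.X) (s : W₁.selmerInfty κ₁) :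
    D₁.toDual (dualMap D₁ D₂ Φ hΦ x) s = D₂.toDual x (Φ s) :=
  toDual_dualHom_apply D₁.toDual D₁.bijective D₂.toDual Φ x s

/-- `dualMap` is `dualHom` on elements. [cite: GreenbergLNM1716, §1 (p. 60)] -/
theorem dualMap_apply (x : D₂.X) :
    dualMap D₁ D₂ Φ hΦ x = dualHom D₁.toDual D₁.bijective D₂.toDual Φ x :=
  rfl

/-- **Kernel bound**: if `n • Sel₂ ⊆ Φ(Sel₁)` then `n` kills `ker Φ^∨`.
[cite: DokchitserDokchitserAnnals2010, Lemma 4.14 (proof)] -/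
theorem smul_eq_zero_of_dualMap_eq_zero {n : ℕ} (hn : ∀ t, ∃ s, Φ s = n • t) {x : D₂.X}
    (hx : dualMap D₁ D₂ Φ hΦ x = 0) : n • x = 0 :=
  smul_eq_zero_of_dualHom_eq_zero D₁.toDual D₁.bijective D₂.toDual D₂.bijective Φ hn hx

/-- **Cokernel bound**: if `n` kills `ker Φ` then `n • X₁ ⊆ Φ^∨(X₂)`.
[cite: DokchitserDokchitserAnnals2010, Lemma 4.14 (proof)] -/
theorem exists_dualMap_eq_smul {n : ℕ} (hn : ∀ s, Φ s = 0 → n • s = 0) (y : D₁.X) :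
    ∃ x : D₂.X, dualMap D₁ D₂ Φ hΦ x = n • y :=
  exists_dualHom_eq_smul D₁.toDual D₁.bijective D₂.toDual D₂.bijective Φ hn y

variable {K₁' : Type u} [Field K₁'] [NumberField K₁'] {W₁' : WeierstrassCurve K₁'} {κ₁' : ZpExtension K₁' p}
  {γ₁' : Field.absoluteGaloisGroup K₁'} (D₁' : W₁'.SelmerDualData κ₁' γ₁')
  (Φ' : W₁'.selmerInfty κ₁' →+ W₂.selmerInfty κ₂)
  (hΦ' : ∀ s, Φ' (W₁'.conjSelmerInfty κ₁' γ₁' s) = W₂.conjSelmerInfty κ₂ γ₂ (Φ' s))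

/-- **Kernel bound, two-map version** (comparison `(s, s') ↦ Φ s + Φ' s'` with image containing `n • Sel₂`):
a common zero of `Φ^∨` and `Φ'^∨` is killed by `n`. [cite: DokchitserDokchitserAnnals2010, Lemma 4.14 (proof)] -/
theorem smul_eq_zero_of_dualMap_eq_zero₂ {n : ℕ} (hn : ∀ t, ∃ s s', Φ s + Φ' s' = n • t) {x : D₂.X}
    (hx : dualMap D₁ D₂ Φ hΦ x = 0) (hx' : dualMap D₁' D₂ Φ' hΦ' x = 0) : n • x = 0 :=
  smul_eq_zero_of_dualHom_eq_zero₂ D₁.toDual D₁.bijective D₂.toDual D₂.bijective Φ D₁'.toDual D₁'.bijective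
    Φ' hn hx hx'

/-- **Cokernel bound, two-map version**: if `Φ s + Φ' s' = 0` forces `n • s = 0 = n • s'`, then
`(n • y, n • y') = (Φ^∨ x, Φ'^∨ x)` for some `x`. [cite: DokchitserDokchitserAnnals2010, Lemma 4.14 (proof)] -/
theorem exists_dualMap_pair_eq_smul {n : ℕ} (hn : ∀ s s', Φ s + Φ' s' = 0 → n • s = 0 ∧ n • s' = 0)
    (y : D₁.X) (y' : D₁'.X) :
    ∃ x : D₂.X, dualMap D₁ D₂ Φ hΦ x = n • y ∧ dualMap D₁' D₂ Φ' hΦ' x = n • y' :=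
  exists_dualHom_pair_eq_smul D₁.toDual D₁.bijective D₂.toDual D₂.bijective Φ D₁'.toDual D₁'.bijective
    Φ' hn y y'

end SelmerDualData

end WeierstrassCurve

end
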